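import Mathlib
import HarnessLib
import Summits.ValiantsHypothesis.ValiantsHypothesis.Theorems.MonotoneRestorationOrbitRestorationQPPerNotNarrow

/-!
# R1 (`OrbitRestorationLinearVolumeQP`, stmt-ValiantsHypothesis-18294): the polylog-treewidth floor

Route MonotoneRestoration, item R1 (the linear-volume re-target).  Its informal statement names as first sub-rungs
"patterns of polylog treewidth (trivial direction, DawarPagoSeppelt2025 §5)".  This file records that floor as a
theorem of the tree, with NO VP hypothesis, NO volume bound and NO dimension bound: if a family is, level by level,
ANY finite combination of homomorphism polynomials of bipartite multigraph patterns of treewidth `≤ (log₂ n + c)^c`,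
then it has square-symmetric circuits of orbit size `≤ 2^((log₂ n + c + 3)^(c + 3))` — the conclusion of R1.

* `orbitRestoration_of_polylogTreewidth` — the floor (from K2 = `OrbitRestorationQPHomPolyClose.stub_homPoly_close`
  and K3 = `stub_close_orbit` through `qpOrbit_of_mem_narrowSpan`; the combination is a member of the narrow span).

So R1 is open exactly for pattern families of super-polylogarithmic treewidth (and, by
`…LinearVolumeQPPerExcluded.lean`, the permanent is not even in its hypothesis class).  Honest framing: the trivial
direction; R1, the crux and `VP ≠ VNP` are untouched. [cite: DawarPagoSeppelt2025, §5 (proof of Thm 5.3)]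
-/

noncomputable section

open MvPolynomial

-- `Summit.ValiantsHypothesis.ValiantsHypothesis.…` is the tree's single-conjunct layout (Sub = Summit).
set_option linter.dupNamespace false

namespace Summit.ValiantsHypothesis.ValiantsHypothesis.Theorems

namespace PolylogTreewidthFloor

open Literature.Computability.AlgebraicComplexity OrbitRestorationQPHomPolyClose

/-- **The polylog-treewidth floor of R1**: a family that is, at every level `n`, a finite combination of homomorphism
polynomials of bipartite multigraph patterns of treewidth `≤ (log₂ n + c)^c` has square-symmetric circuits of orbit
size `≤ 2^((log₂ n + c + 3)^(c + 3))`. [cite: DawarPagoSeppelt2025, §5 (proof of Thm 5.3)] -/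
theorem orbitRestoration_of_polylogTreewidth (f : (n : ℕ) → MvPolynomial (Fin n × Fin n) ℂ) (c : ℕ)
    (m : ℕ → ℕ) (a b : (n : ℕ) → Fin (m n) → ℕ)
    (E : (n : ℕ) → (i : Fin (m n)) → Multiset (Fin (a n i) × Fin (b n i))) (α : (n : ℕ) → Fin (m n) → ℂ)
    (htw : ∀ n i, Literature.Combinatorics.SimpleGraph.treewidth
        (SimpleGraph.fromRel fun u v : Fin (a n i) ⊕ Fin (b n i) =>
          ∃ e ∈ E n i, u = Sum.inl e.1 ∧ v = Sum.inr e.2) ≤ (Nat.log 2 n + c) ^ c)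
    (hf : ∀ n, f n = ∑ i : Fin (m n), MvPolynomial.C (α n i) * homPoly (E n i) n ℂ) :
    ∀ n : ℕ, ∃ (G : Type) (_ : Fintype G) (C : LabelledArithCircuit ℂ (Fin n × Fin n) Unit G),
      C.IsSymmetric (Equiv.Perm (Fin n)) ∧ C.eval (C.output ()) = f n ∧
        C.orbitSize (Equiv.Perm (Fin n)) ≤ 2 ^ ((Nat.log 2 n + (c + 3)) ^ (c + 3)) := by
  refine qpOrbit_of_mem_narrowSpan f c fun n => ?_
  rw [hf n]
  refine Submodule.sum_mem _ fun i _ => ?_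
  rw [← smul_eq_C_mul]
  exact Submodule.smul_mem _ _ (Submodule.subset_span ⟨a n i, b n i, E n i, htw n i, rfl⟩)

/-- The same in the family form of R1's conclusion (`∃ c', ∀ n, …`). [cite: DawarPagoSeppelt2025, §5 (proof of Thm 5.3)] -/
theorem orbitRestoration_of_polylogTreewidth' (f : (n : ℕ) → MvPolynomial (Fin n × Fin n) ℂ)
    (h : ∃ (c : ℕ) (m : ℕ → ℕ) (a b : (n : ℕ) → Fin (m n) → ℕ)
      (E : (n : ℕ) → (i : Fin (m n)) → Multiset (Fin (a n i) × Fin (b n i))) (α : (n : ℕ) → Fin (m n) → ℂ),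
      (∀ n i, Literature.Combinatorics.SimpleGraph.treewidth
        (SimpleGraph.fromRel fun u v : Fin (a n i) ⊕ Fin (b n i) =>
          ∃ e ∈ E n i, u = Sum.inl e.1 ∧ v = Sum.inr e.2) ≤ (Nat.log 2 n + c) ^ c) ∧
      ∀ n, f n = ∑ i : Fin (m n), MvPolynomial.C (α n i) * homPoly (E n i) n ℂ) :
    ∃ c : ℕ, ∀ n : ℕ, ∃ (G : Type) (_ : Fintype G) (C : LabelledArithCircuit ℂ (Fin n × Fin n) Unit G),
      C.IsSymmetric (Equiv.Perm (Fin n)) ∧ C.eval (C.output ()) = f n ∧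
        C.orbitSize (Equiv.Perm (Fin n)) ≤ 2 ^ ((Nat.log 2 n + c) ^ c) := by
  obtain ⟨c, m, a, b, E, α, htw, hf⟩ := h
  exact ⟨c + 3, orbitRestoration_of_polylogTreewidth f c m a b E α htw hf⟩

end PolylogTreewidthFloor

end Summit.ValiantsHypothesis.ValiantsHypothesis.Theorems

end
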